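import Summits.ResolutionOfSingularities.ResolutionOfSingularities.Theorems.PurelyInseparableDim4ResConeCInfLegalityPrime
import Summits.ResolutionOfSingularities.ResolutionOfSingularities.Theorems.PurelyInseparableDim4ResConeCInfGameStepPrime
import Summits.ResolutionOfSingularities.ResolutionOfSingularities.Theorems.PurelyInseparableDim4ResConeCInfGameReadings
import Summits.ResolutionOfSingularities.ResolutionOfSingularities.Theorems.PurelyInseparableDim4ResConeCInfGame
import HarnessLib
import HarnessLib.Audit.Tags

/-!
# Purely inseparable four-folds — NO INFINITE PURE-CORNER C∞ TAIL, EVERY PRIME: an infinite sequence of pure corner steps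
# in slot charts of STRAIGHT isolated light-pair power-cone states at `(p, p − 1)` with the exact pair ledger plays
# res-dim4-p-9's C∞ game legally with both flags for ever — impossible (`CInfGame.no_infinite_play`)
# (cell `res-dim4-pi`, K2(p) lane, rung-1 power-cone line «light pair of TAIL(p, p−1, 3) ∀ p», FILE 3 = the GAME HALF)

[OURS · counted 0 · cell `res-dim4-pi` · K2(p) lane (holder res-dim4-p-12 g5, ruling g5-2 (6)); `(5, 4)` instance: p-3 g4's
`cInf_window_false` (9-step window) — here the tail is infinite and the game is res-dim4-p-9 g3's p-free
`CInfGame.no_infinite_play`; seat res-dim4-p-3 g5.]  Nothing here proves K2(p) for any `p`, any TAIL(p, p−1, 3),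
`NoIsolatedTrap p p`, the Cossart–Jannsen–Saito theorem or resolution of singularities in dimension ≥ 4 / characteristic `p` —
NOT proved.  AI kernel work, weaker than expert review.  This is the GAME HALF of the light sub-row of the power-cone slots (B1)
for every prime; the TRANSPORT HALF (a straight frame with exact ledger from a real tail with translations and rotations —
typ-1 lineage's `…SwapTransportWindow*` at `(5,4)`) is NOT here, so no tail statement is closed by this file.

Letters `λ, μ` (slots), `u` (free), `f` (contact); `d + 1 = p`, `2 ≤ d`.  PURE-CORNER C∞ TAIL: `c (t+1) = step p univ (j t) 0 (c t)`,
`j t ∈ {λ, μ}`, every state isolated of order `d + 2` with `e_G = 3`, ledger `r_t = x_λ x_μ ∣ F_t`; at `t = 0` the residual cone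
is STRAIGHT at `f` in coefficients and the EXACT pair ledger holds (`x_f`-degree `≤ d − 1` ⇒ `x_λ², x_μ² ∣`).
* §1 bookkeeping ∀ p: `straight_support_of_straight_prime`, `succ_le_degree_of_straight_prime`, `tsch_row_of_ledger_prime`;
  §2 readings ∀ p (ports of `…CInfGameReadings` §2–§4): **`cInf_hleg_of_corner_prime`**, **`cInf_hflag_of_isolated_prime`**,
  **`cInf_hevol_of_corner_prime`**.
* §3 **`cInf_corner_invariant_prime`** (straightness + exact ledger PROPAGATE: F3 ∀ p (i)(ii) + `ledger_step_zero_prime`);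
  **`no_cInf_corner_tail_prime`** — THE THEOREM: `False`, by `CInfGame.no_infinite_play` on the supports
  `P t (c,a,b,e) :⟺ c + 1 ≤ d ∧ coeff ((a+2)λ + (b+2)μ + e·u + (d−1−c)f) F_t ≠ 0` along `x t := (j t = λ)`.
[cite: CossartJannsenSaito2020, Thm. 3.14, Lemma 13.2]  bears_on: LADDER-RESOLUTION:D157-DOOR2 (res-dim4-pi · K2(p) · power cones). -/

set_option linter.dupNamespace false -- mandated namespace of this single-conjunct summit

noncomputable section

namespace Summit.ResolutionOfSingularities.ResolutionOfSingularities.Theorems.PIDim4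

namespace ResCone

open MvPolynomial Finset
open Literature.AlgebraicGeometry.Resolution
open Literature.AlgebraicGeometry.Resolution.CentreBlowup
open Literature.AlgebraicGeometry.Resolution.Hauser2010
open Literature.AlgebraicGeometry.Resolution.HauserPerlega2019

variable {K : Type} [Field K]

/-! ## §1 Bookkeeping, every prime -/

/-- **Straight support, every prime**: `x^r ∣ F` (`|r| = 2`, `r_f = 0`) and vanishing residual degree-`d` readings off `d·e_f`
force `x_f`-exponent `d` on every degree-`(d + 2)` monomial of `F`. [OURS · bookkeeping] -/
theorem straight_support_of_straight_prime {f : Fin 4} {s : State K} {d : ℕ} (hdiv : ∀ e ∈ s.F.support, s.r ≤ e)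
    (hrdeg : s.r.degree = 2) (hrf : s.r f = 0)
    (hstraight : ∀ m : Fin 4 →₀ ℕ, m.degree = d → m ≠ Finsupp.single f d → coeff (s.r + m) s.F = 0) :
    ∀ e ∈ s.F.support, e.degree = d + 2 → e f = d := by
  intro e he hdeg
  have hle := hdiv e he
  have he' : e = s.r + (e - s.r) := (add_tsub_cancel_of_le hle).symm
  have hmdeg : (e - s.r).degree = d := by
    have := congrArg Finsupp.degree he'
    rw [map_add, hdeg, hrdeg] at this
    omega
  by_cases hm : e - s.r = Finsupp.single f d
  · have := DFunLike.congr_fun he' f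
    rw [Finsupp.add_apply, hrf, hm, Finsupp.single_eq_same, zero_add] at this
    exact this
  · exfalso
    have h0 := hstraight (e - s.r) hmdeg hm
    rw [← he'] at h0
    exact (mem_support_iff.mp he) h0

/-- Every monomial of `x_f`-degree `≤ d − 1` of a straight state of order `d + 2` has degree `≥ d + 3`. [OURS · bookkeeping] -/
theorem succ_le_degree_of_straight_prime {f : Fin 4} {s : State K} {d : ℕ} (hd1 : 1 ≤ d)
    (ho : ordZero s.F = ((d + 2 : ℕ) : ℕ∞)) (hdiv : ∀ e ∈ s.F.support, s.r ≤ e) (hrdeg : s.r.degree = 2)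
    (hrf : s.r f = 0)
    (hstraight : ∀ m : Fin 4 →₀ ℕ, m.degree = d → m ≠ Finsupp.single f d → coeff (s.r + m) s.F = 0) :
    ∀ e ∈ s.F.support, e f ≤ d - 1 → d + 3 ≤ e.degree := by
  intro e he hef
  have h6 := le_degree_of_ordZero_eq ho e he
  by_contra hlt
  have h4 := straight_support_of_straight_prime hdiv hrdeg hrf hstraight e he (by omega)
  omega

/-- **The Tschirnhaus / ledger row from the exact ledger, every prime**: if every monomial of `x_f`-degree `≤ d − 1` has
`x_o`-exponent `≥ 2`, the reading `coeff_{r + (d−1)e_f + 2e_κ} F` (`r = e_κ + e_o`) vanishes — F3's `htsch`.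
[OURS · bookkeeping] -/
theorem tsch_row_of_ledger_prime {κ o f : Fin 4} (hκo : κ ≠ o) (hκf : κ ≠ f) (hof : o ≠ f) {s : State K} {d : ℕ}
    (hr : s.r = Finsupp.single κ 1 + Finsupp.single o 1)
    (hled : ∀ e ∈ s.F.support, e f ≤ d - 1 → 2 ≤ e o) :
    coeff (s.r + (Finsupp.single f (d - 1) + Finsupp.single κ 2)) s.F = 0 := by
  by_contra h
  have hmem := mem_support_iff.mpr h
  have hf : (s.r + (Finsupp.single f (d - 1) + Finsupp.single κ 2) : Fin 4 →₀ ℕ) f = d - 1 := by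
    rw [hr]; simp [Finsupp.add_apply, hκf, hof]
  have ho' : (s.r + (Finsupp.single f (d - 1) + Finsupp.single κ 2) : Fin 4 →₀ ℕ) o = 1 := by
    rw [hr]; simp [Finsupp.add_apply, hκo, hof.symm]
  have := hled _ hmem (by rw [hf])
  rw [ho'] at this
  omega

/-! ## §2 The three game readings, every prime -/

section Readings

variable [DecidableEq K]
variable {κ o u f : Fin 4} (hκo : κ ≠ o) (hκu : κ ≠ u) (hκf : κ ≠ f) (hou : o ≠ u) (hof : o ≠ f) (huf : u ≠ f)
include hκo hκu hκf hou hof huf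

/-- **LEGALITY OF THE LETTER PLAYED, every prime** (p-9's `hlegL` / `hlegM`): in the C∞ frame at a straight state `s`
(boundary `e_κ + e_o`, `x^r ∣ F`, `ord₀ F = d + 2`, straight at `f`, Tschirnhaus row) whose pure-corner child in the chart of
`κ` has again `ord₀ = d + 2` and `e_G = 3`, every PRESENT game monomial `E(c,a,b,e) = (a+2)e_κ + (b+2)e_o + e·e_u + (d−1−c)e_f`
(`c + 1 ≤ d`; `a` = exponent of the chart letter) satisfies `2c ≤ a + 2b + 2e`. [OURS] [cite: CossartJannsenSaito2020, Thm. 3.14] -/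
theorem cInf_hleg_of_corner_prime (p : ℕ) [Fact p.Prime] [CharP K p] {d : ℕ} (hdp : d + 1 = p) (hd2 : 2 ≤ d)
    {s : State K} (hr : s.r = Finsupp.single κ 1 + Finsupp.single o 1)
    (hdiv : ∀ e ∈ s.F.support, s.r ≤ e) (ho : ordZero s.F = ((d + 2 : ℕ) : ℕ∞))
    (ha : coeff (s.r + Finsupp.single f d) s.F ≠ 0)
    (hstraight : ∀ m : Fin 4 →₀ ℕ, m.degree = d → m ≠ Finsupp.single f d → coeff (s.r + m) s.F = 0)
    (htsch : coeff (s.r + (Finsupp.single f (d - 1) + Finsupp.single κ 2)) s.F = 0)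
    (ho' : ordZero (CentreBlowup.step p Finset.univ κ 0 s).F = ((d + 2 : ℕ) : ℕ∞))
    (he3' : Module.finrank K (resVertex (CentreBlowup.step p Finset.univ κ 0 s)) = 3)
    {c : ℕ} (hc : c + 1 ≤ d) {a b e : ℕ}
    (h : coeff (Finsupp.single κ (a + 2) + Finsupp.single o (b + 2) + Finsupp.single u e +
      Finsupp.single f (d - 1 - c)) s.F ≠ 0) : 2 * c ≤ a + 2 * b + 2 * e := by
  have hrdeg : s.r.degree = 2 := by rw [hr, map_add, Finsupp.degree_single, Finsupp.degree_single]
  have hrf : s.r f = 0 := by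
    rw [hr, Finsupp.add_apply, Finsupp.single_eq_of_ne hκf.symm, Finsupp.single_eq_of_ne hof.symm, add_zero]
  -- no truncation: `c ≤ a + b + e`
  have hle : c ≤ a + b + e :=
    le_of_coeff_gameExp_ne_zero_prime hκo hκu hκf hou hof huf s (le_degree_of_ordZero_eq ho)
      (straight_support_of_straight_prime hdiv hrdeg hrf hstraight) hc h
  -- F3 (iii): no `κ`-blocker among the residual exponents
  obtain ⟨-, -, hleg⟩ := cInf_legal_readings_of_corner_prime p hdp hd2 hκo hκf hof hr hdiv ho ha hstraight htsch ho' he3'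
  by_contra hlt
  rw [not_le] at hlt
  have hm := hleg (Finsupp.single κ (a + 1) + Finsupp.single o (b + 1) + Finsupp.single u e +
    Finsupp.single f (d - 1 - c)) (by rw [degree_quad]; omega)
    (by rw [degree_quad, (quad_apply hκo hκu hκf hou hof huf (a + 1) (b + 1) e (d - 1 - c)).1]; omega)
    (fun heq => by
      have := DFunLike.congr_fun heq κ
      rw [(quad_apply hκo hκu hκf hou hof huf (a + 1) (b + 1) e (d - 1 - c)).1, Finsupp.single_eq_of_ne hκf] at this
      omega)
  rw [hr, pair_add_resExp hκo hκu hκf hou hof huf] at hm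
  exact h hm

omit [DecidableEq K] in
/-- **THE FLAG OF A LEDGER LETTER from isolation, every prime** (`hflagL` for `l = κ`): an ISOLATED state with ledger
`r = e_κ + e_o`, `x^r ∣ F` and the exact pair-ledger support form carries a PRESENT game monomial `E(c,a,b,e)` with `c + 1 ≤ d`
and `b + e + 1 ≤ c` (a `κ`-WITNESS). [OURS] [cite: CossartJannsenSaito2020, Thm. 3.14] -/
theorem cInf_hflag_of_isolated_prime (p : ℕ) {d : ℕ} (hdp : d + 1 = p) {s : State K} (hiso : IsIsolated p s.F)
    (hdiv : ∀ e ∈ s.F.support, s.r ≤ e) (hr : s.r = Finsupp.single κ 1 + Finsupp.single o 1)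
    (hled : ∀ e ∈ s.F.support, e f ≤ d - 1 → 2 ≤ e κ ∧ 2 ≤ e o) :
    ∃ c a b e : ℕ, c + 1 ≤ d ∧
      coeff (Finsupp.single κ (a + 2) + Finsupp.single o (b + 2) + Finsupp.single u e +
        Finsupp.single f (d - 1 - c)) s.F ≠ 0 ∧ b + e + 1 ≤ c := by
  have hrκ : s.r κ = 1 := by
    rw [hr, Finsupp.add_apply, Finsupp.single_eq_same, Finsupp.single_eq_of_ne hκo, add_zero]
  have hro : s.r o = 1 := by
    rw [hr, Finsupp.add_apply, Finsupp.single_eq_of_ne (Ne.symm hκo), Finsupp.single_eq_same, zero_add]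
  have hrf : s.r f = 0 := by
    rw [hr, Finsupp.add_apply, Finsupp.single_eq_of_ne hκf.symm, Finsupp.single_eq_of_ne hof.symm, add_zero]
  have hrdeg : s.r.degree = 2 := by rw [hr, map_add, Finsupp.degree_single, Finsupp.degree_single]
  obtain ⟨m, hm, hmdeg⟩ := cInf_flag_reading_prime p hiso hdiv hrκ hrdeg
  have hmq := eq_sum_single_four hκo hκu hκf hou hof huf m
  have hmd : m.degree = m κ + m o + m u + m f := by
    conv_lhs => rw [hmq]
    exact degree_quad κ o u f _ _ _ _
  -- the witness lies in the support, with `x_f`-degree `≤ d − 1`: the ledger makes it a game monomial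
  have hmem : s.r + m ∈ s.F.support := mem_support_iff.mpr hm
  have hmf : m f ≤ d - 1 := by omega
  obtain ⟨h2κ, h2o⟩ := hled _ hmem (by rw [Finsupp.add_apply, hrf, zero_add]; exact hmf)
  rw [Finsupp.add_apply, hrκ] at h2κ
  rw [Finsupp.add_apply, hro] at h2o
  refine ⟨d - 1 - m f, m κ - 1, m o - 1, m u, by omega, ?_, by omega⟩
  have heq : (Finsupp.single κ (m κ - 1 + 2) + Finsupp.single o (m o - 1 + 2) + Finsupp.single u (m u) +
      Finsupp.single f (d - 1 - (d - 1 - m f)) : Fin 4 →₀ ℕ) = s.r + m := by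
    rw [hr, show m κ - 1 + 2 = (m κ - 1) + 1 + 1 by omega, show m o - 1 + 2 = (m o - 1) + 1 + 1 by omega,
      show d - 1 - (d - 1 - m f) = m f by omega, ← pair_add_resExp hκo hκu hκf hou hof huf,
      show m κ - 1 + 1 = m κ by omega, show m o - 1 + 1 = m o by omega, ← hmq]
  rw [heq]
  exact hm

/-- **BACKWARD LAW, every prime** (the live branch of p-9's `hevol`): with the exact support form at the parent
(«`x_f`-degree `≤ d − 1` ⇒ `x_κ`-exponent `≥ 2`»), every game monomial `E(c, a′, b, e)` present at the pure-corner child in the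
chart of `κ` has a present game parent `E(c, a₀, b, e)` with `a′ + c = a₀ + b + e`. [OURS] [cite: CossartJannsenSaito2020, Lemma 13.2] -/
theorem cInf_hevol_of_corner_prime (p : ℕ) {d : ℕ} (hdp : d + 1 = p) (s : State K)
    (hr1 : ∀ e ∈ s.F.support, 1 ≤ e κ) (hled : ∀ e ∈ s.F.support, e f ≤ d - 1 → 2 ≤ e κ) {c : ℕ} (hc : c + 1 ≤ d)
    {a' b e : ℕ}
    (h : coeff (Finsupp.single κ (a' + 2) + Finsupp.single o (b + 2) + Finsupp.single u e +
      Finsupp.single f (d - 1 - c)) (CentreBlowup.step p Finset.univ κ 0 s).F ≠ 0) :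
    ∃ a₀, coeff (Finsupp.single κ (a₀ + 2) + Finsupp.single o (b + 2) + Finsupp.single u e +
        Finsupp.single f (d - 1 - c)) s.F ≠ 0 ∧ a' + c = a₀ + b + e :=
  exists_parent_of_coeff_step_zero_gameExp_of_ledger_prime hκo hκu hκf hou hof huf p hdp s hr1 hled hc h

end Readings

/-! ## §3 The pure-corner C∞ tail: invariants and the contradiction, every prime -/

section Tail

variable [DecidableEq K]
variable {la mu u f : Fin 4} (hlm : la ≠ mu) (hlu : la ≠ u) (hlf : la ≠ f) (hmu : mu ≠ u) (hmf : mu ≠ f)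
  (huf : u ≠ f)
include hlm hlu hlf hmu hmf huf

omit hlu hmu huf in
/-- **STRAIGHTNESS AND THE EXACT PAIR LEDGER RIDE A PURE-CORNER C∞ TAIL, every prime**: along pure corner steps in slot charts
of isolated states of order `d + 2` with `e_G = 3` and ledger `x_λ x_μ`, the coefficient-straightness at `f` and the support form
«`x_f`-degree `≤ d − 1` ⇒ `x_λ², x_μ² ∣`» propagate from `t = 0` to every `t` (F3 ∀ p (i)(ii) + `ledger_step_zero_prime`).
[OURS] [cite: CossartJannsenSaito2020, Thm. 3.14, Lemma 13.2] -/
theorem cInf_corner_invariant_prime (p : ℕ) [Fact p.Prime] [CharP K p] {d : ℕ} (hdp : d + 1 = p) (hd2 : 2 ≤ d)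
    {c : ℕ → State K} {j : ℕ → Fin 4}
    (ho : ∀ t, ordZero (c t).F = ((d + 2 : ℕ) : ℕ∞)) (he3 : ∀ t, Module.finrank K (resVertex (c t)) = 3)
    (hdiv : ∀ t, ∀ e ∈ (c t).F.support, (c t).r ≤ e)
    (hstep : ∀ t, c (t + 1) = CentreBlowup.step p Finset.univ (j t) 0 (c t)) (hslot : ∀ t, j t = la ∨ j t = mu)
    (hr : ∀ t, (c t).r = Finsupp.single la 1 + Finsupp.single mu 1)
    (ha0 : coeff ((c 0).r + Finsupp.single f d) (c 0).F ≠ 0)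
    (hstraight0 : ∀ m : Fin 4 →₀ ℕ, m.degree = d → m ≠ Finsupp.single f d → coeff ((c 0).r + m) (c 0).F = 0)
    (hled0 : ∀ e ∈ (c 0).F.support, e f ≤ d - 1 → 2 ≤ e la ∧ 2 ≤ e mu) :
    ∀ t, coeff ((c t).r + Finsupp.single f d) (c t).F ≠ 0 ∧
      (∀ m : Fin 4 →₀ ℕ, m.degree = d → m ≠ Finsupp.single f d → coeff ((c t).r + m) (c t).F = 0) ∧
      (∀ e ∈ (c t).F.support, e f ≤ d - 1 → 2 ≤ e la ∧ 2 ≤ e mu) := by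
  intro t
  induction t with
  | zero => exact ⟨ha0, hstraight0, hled0⟩
  | succ t ih =>
    obtain ⟨ha, hstraight, hled⟩ := ih
    have hrdeg : (c t).r.degree = 2 := by rw [hr t, map_add, Finsupp.degree_single, Finsupp.degree_single]
    have hrf : (c t).r f = 0 := by
      rw [hr t, Finsupp.add_apply, Finsupp.single_eq_of_ne hlf.symm, Finsupp.single_eq_of_ne hmf.symm, add_zero]
    have h7 := succ_le_degree_of_straight_prime (by omega) (ho t) (hdiv t) hrdeg hrf hstraight
    have hrswap : (c t).r = Finsupp.single mu 1 + Finsupp.single la 1 := by rw [hr t, add_comm]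
    have hr' : (c (t + 1)).r = (c t).r := by rw [hr (t + 1), hr t]
    rcases hslot t with hj | hj
    · -- chart `λ`
      have hst := hstep t
      rw [hj] at hst
      have ho' : ordZero (CentreBlowup.step p Finset.univ la 0 (c t)).F = ((d + 2 : ℕ) : ℕ∞) := by
        rw [← hst]; exact ho (t + 1)
      have he3' : Module.finrank K (resVertex (CentreBlowup.step p Finset.univ la 0 (c t))) = 3 := by
        rw [← hst]; exact he3 (t + 1)
      obtain ⟨hz, hx, -⟩ := cInf_legal_readings_of_corner_prime p hdp hd2 hlm hlf hmf (hr t) (hdiv t) (ho t) ha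
        hstraight (tsch_row_of_ledger_prime hlm hlf hmf (hr t) (fun e he hef => (hled e he hef).2)) ho' he3'
      refine ⟨?_, fun m hm hne => ?_, ?_⟩
      · rw [hr', hst, hx]; exact ha
      · rw [hr', hst]; exact hz m hm hne
      · rw [hst]
        exact ledger_step_zero_prime hlm hlf p hdp (c t) h7 hled
    · -- chart `μ`: slots swapped
      have hst := hstep t
      rw [hj] at hst
      have ho' : ordZero (CentreBlowup.step p Finset.univ mu 0 (c t)).F = ((d + 2 : ℕ) : ℕ∞) := by
        rw [← hst]; exact ho (t + 1)
      have he3' : Module.finrank K (resVertex (CentreBlowup.step p Finset.univ mu 0 (c t))) = 3 := by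
        rw [← hst]; exact he3 (t + 1)
      obtain ⟨hz, hx, -⟩ := cInf_legal_readings_of_corner_prime p hdp hd2 (Ne.symm hlm) hmf hlf hrswap (hdiv t) (ho t)
        ha hstraight (tsch_row_of_ledger_prime (Ne.symm hlm) hmf hlf hrswap (fun e he hef => (hled e he hef).1))
        ho' he3'
      refine ⟨?_, fun m hm hne => ?_, ?_⟩
      · rw [hr', hst, hx]; exact ha
      · rw [hr', hst]; exact hz m hm hne
      · rw [hst]
        intro e he hef
        exact (ledger_step_zero_prime (Ne.symm hlm) hmf p hdp (c t) h7
          (fun e' he' hef' => (hled e' he' hef').symm) e he hef).symm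

/-- **NO INFINITE PURE-CORNER C∞ TAIL, EVERY PRIME** (the game half of the light sub-row of the power-cone slots).  Fixed letters
`λ, μ, u, f`, `d + 1 = p`, `2 ≤ d`; states `c t` and slot charts `j t ∈ {λ, μ}` with pure corner steps
`c (t+1) = step p univ (j t) 0 (c t)` for EVERY `t`, every state ISOLATED of order `d + 2` with `e_G = 3`, ledger
`r_t = x_λ x_μ ∣ F_t`; at `t = 0` the residual cone is straight at `f` (in coefficients) and the exact pair ledger holds.  Then
`False`: the supports `P t (c,a,b,e) :⟺ c + 1 ≤ d ∧ coeff ((a+2)λ + (b+2)μ + e·u + (d−1−c)f) F_t ≠ 0` along `x t := (j t = λ)`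
form an infinite LEGAL DOUBLY-FLAGGED play of res-dim4-p-9's C∞ game from a finite initial support, which
`CInfGame.no_infinite_play` forbids. [OURS] [cite: CossartJannsenSaito2020, Thm. 3.14] -/
theorem no_cInf_corner_tail_prime (p : ℕ) [Fact p.Prime] [CharP K p] {d : ℕ} (hdp : d + 1 = p) (hd2 : 2 ≤ d)
    {c : ℕ → State K} {j : ℕ → Fin 4} (hiso : ∀ t, IsIsolated p (c t).F)
    (ho : ∀ t, ordZero (c t).F = ((d + 2 : ℕ) : ℕ∞)) (he3 : ∀ t, Module.finrank K (resVertex (c t)) = 3)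
    (hdiv : ∀ t, ∀ e ∈ (c t).F.support, (c t).r ≤ e)
    (hstep : ∀ t, c (t + 1) = CentreBlowup.step p Finset.univ (j t) 0 (c t)) (hslot : ∀ t, j t = la ∨ j t = mu)
    (hr : ∀ t, (c t).r = Finsupp.single la 1 + Finsupp.single mu 1)
    (ha0 : coeff ((c 0).r + Finsupp.single f d) (c 0).F ≠ 0)
    (hstraight0 : ∀ m : Fin 4 →₀ ℕ, m.degree = d → m ≠ Finsupp.single f d → coeff ((c 0).r + m) (c 0).F = 0)
    (hled0 : ∀ e ∈ (c 0).F.support, e f ≤ d - 1 → 2 ≤ e la ∧ 2 ≤ e mu) : False := by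
  classical
  have hinv := cInf_corner_invariant_prime hlm hlf hmf p hdp hd2 ho he3 hdiv hstep hslot hr ha0 hstraight0 hled0
  have hrdeg : ∀ t, (c t).r.degree = 2 := fun t => by
    rw [hr t, map_add, Finsupp.degree_single, Finsupp.degree_single]
  have hrf : ∀ t, (c t).r f = 0 := fun t => by
    rw [hr t, Finsupp.add_apply, Finsupp.single_eq_of_ne hlf.symm, Finsupp.single_eq_of_ne hmf.symm, add_zero]
  have hq : ∀ t, ((p : ℕ) : ℕ∞) ≤ ordAlong Finset.univ (c t).F := fun t => by
    rw [ordAlong_univ, ho t]; exact_mod_cast (by omega : p ≤ d + 2)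
  have h6 : ∀ t, ∀ e ∈ (c t).F.support, d + 2 ≤ e.degree := fun t => le_degree_of_ordZero_eq (ho t)
  have hss : ∀ t, ∀ e ∈ (c t).F.support, e.degree = d + 2 → e f = d := fun t =>
    straight_support_of_straight_prime (hdiv t) (hrdeg t) (hrf t) (hinv t).2.1
  have hla1 : ∀ t, ∀ e ∈ (c t).F.support, 1 ≤ e la := fun t e he => by
    have h := hdiv t e he la
    rw [hr t, Finsupp.add_apply, Finsupp.single_eq_same, Finsupp.single_eq_of_ne hlm] at h
    omega
  have hmu1 : ∀ t, ∀ e ∈ (c t).F.support, 1 ≤ e mu := fun t e he => by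
    have h := hdiv t e he mu
    rw [hr t, Finsupp.add_apply, Finsupp.single_eq_of_ne (Ne.symm hlm), Finsupp.single_eq_same] at h
    omega
  have hrswap : ∀ t, (c t).r = Finsupp.single mu 1 + Finsupp.single la 1 := fun t => by rw [hr t, add_comm]
  -- legality at a step `t` in the chart `κ ∈ {λ, μ}`: the F3 frame at `c t`
  have hleg : ∀ t, ∀ {κ o : Fin 4}, κ ≠ o → κ ≠ u → κ ≠ f → o ≠ u → o ≠ f → j t = κ →
      (c t).r = Finsupp.single κ 1 + Finsupp.single o 1 →
      (∀ e ∈ (c t).F.support, e f ≤ d - 1 → 2 ≤ e o) →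
      ∀ {cc : ℕ}, cc + 1 ≤ d → ∀ {a b e : ℕ},
        coeff (Finsupp.single κ (a + 2) + Finsupp.single o (b + 2) + Finsupp.single u e +
          Finsupp.single f (d - 1 - cc)) (c t).F ≠ 0 → 2 * cc ≤ a + 2 * b + 2 * e := by
    intro t κ o hκo hκu hκf hou hof hj hrκ hledo cc hcc a b e h
    obtain ⟨ha, hstraight, -⟩ := hinv t
    have hst := hstep t
    rw [hj] at hst
    have ho' : ordZero (CentreBlowup.step p Finset.univ κ 0 (c t)).F = ((d + 2 : ℕ) : ℕ∞) := by
      rw [← hst]; exact ho (t + 1)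
    have he3' : Module.finrank K (resVertex (CentreBlowup.step p Finset.univ κ 0 (c t))) = 3 := by
      rw [← hst]; exact he3 (t + 1)
    exact cInf_hleg_of_corner_prime hκo hκu hκf hou hof huf p hdp hd2 hrκ (hdiv t) (ho t) ha hstraight
      (tsch_row_of_ledger_prime hκo hκf hof hrκ hledo) ho' he3' hcc h
  -- the play
  let E : ℕ × ℕ × ℕ × ℕ → (Fin 4 →₀ ℕ) := fun m =>
    Finsupp.single la (m.2.1 + 2) + Finsupp.single mu (m.2.2.1 + 2) + Finsupp.single u m.2.2.2 +
      Finsupp.single f (d - 1 - m.1)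
  let dec : (Fin 4 →₀ ℕ) → ℕ × ℕ × ℕ × ℕ := fun g => (d - 1 - g f, g la - 2, g mu - 2, g u)
  have hdec : ∀ cc a b e : ℕ, cc + 1 ≤ d → dec (E (cc, a, b, e)) = (cc, a, b, e) := by
    intro cc a b e hcc
    obtain ⟨h1, h2, h3, h4⟩ := quad_apply hlm hlu hlf hmu hmf huf (a + 2) (b + 2) e (d - 1 - cc)
    have e1 : d - 1 - (d - 1 - cc) = cc := by omega
    dsimp only [dec, E]
    rw [h1, h2, h3, h4, e1, Nat.add_sub_cancel, Nat.add_sub_cancel]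
  refine CInfGame.no_infinite_play (fun t => decide (j t = la))
    (fun t m => m.1 + 1 ≤ d ∧ coeff (E m) (c t).F ≠ 0) ((c 0).F.support.image dec) ?_ ?_ ?_ ?_ ?_ ?_
  · -- finite initial support
    rintro ⟨cc, a, b, e⟩ ⟨hm1, hm⟩
    exact Finset.mem_image.mpr ⟨E (cc, a, b, e), mem_support_iff.mpr hm, hdec cc a b e hm1⟩
  · -- hevol: backward law (the dead branch is never needed under the exact ledger)
    rintro t ⟨cc, a', b, e⟩ ⟨hcc, h⟩
    dsimp only at hcc h
    left
    have hst := hstep t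
    rcases hslot t with hj | hj
    · rw [hj] at hst
      have h' : coeff (Finsupp.single la (a' + 2) + Finsupp.single mu (b + 2) + Finsupp.single u e +
          Finsupp.single f (d - 1 - cc)) (CentreBlowup.step p Finset.univ la 0 (c t)).F ≠ 0 := by
        rw [← hst]; exact h
      obtain ⟨a₀, ha₀, heq⟩ := cInf_hevol_of_corner_prime hlm hlu hlf hmu hmf huf p hdp (c t) (hla1 t)
        (fun e he hef => ((hinv t).2.2 e he hef).1) hcc h'
      refine ⟨(cc, a₀, b, e), ⟨hcc, ha₀⟩, ?_⟩
      rw [if_pos (decide_eq_true hj)]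
      show ((cc, a', b, e) : ℕ × ℕ × ℕ × ℕ) = (cc, a₀ + b + e - cc, b, e)
      rw [show a₀ + b + e - cc = a' by omega]
    · rw [hj] at hst
      have h' : coeff (Finsupp.single mu (b + 2) + Finsupp.single la (a' + 2) + Finsupp.single u e +
          Finsupp.single f (d - 1 - cc)) (CentreBlowup.step p Finset.univ mu 0 (c t)).F ≠ 0 := by
        rw [← hst, gameExp_swap]; exact h
      obtain ⟨b₀, hb₀, heq⟩ := cInf_hevol_of_corner_prime (Ne.symm hlm) hmu hmf hlu hlf huf p hdp (c t) (hmu1 t)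
        (fun e he hef => ((hinv t).2.2 e he hef).2) hcc h'
      rw [gameExp_swap] at hb₀
      have hx : decide (j t = la) = false := by
        rw [decide_eq_false_iff_not, hj]; exact Ne.symm hlm
      refine ⟨(cc, a', b₀, e), ⟨hcc, hb₀⟩, ?_⟩
      rw [hx]
      show ((cc, a', b, e) : ℕ × ℕ × ℕ × ℕ) = (cc, a', a' + b₀ + e - cc, e)
      rw [show a' + b₀ + e - cc = b by omega]
  · -- hlegL
    rintro t ⟨cc, a, b, e⟩ ⟨hcc, h⟩ hx
    dsimp only at hcc h ⊢
    have hj : j t = la := of_decide_eq_true hx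
    exact hleg t hlm hlu hlf hmu hmf hj (hr t) (fun e he hef => ((hinv t).2.2 e he hef).2) hcc h
  · -- hlegM
    rintro t ⟨cc, a, b, e⟩ ⟨hcc, h⟩ hx
    dsimp only at hcc h ⊢
    have hj : j t = mu := by
      rcases hslot t with h' | h'
      · exact absurd (decide_eq_true h') (by rw [hx]; exact Bool.false_ne_true)
      · exact h'
    have h' : coeff (Finsupp.single mu (b + 2) + Finsupp.single la (a + 2) + Finsupp.single u e +
        Finsupp.single f (d - 1 - cc)) (c t).F ≠ 0 := by rw [gameExp_swap]; exact h
    have := hleg t (Ne.symm hlm) hmu hmf hlu hlf hj (hrswap t) (fun e he hef => ((hinv t).2.2 e he hef).1) hcc h'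
    omega
  · -- hflagL
    intro t
    obtain ⟨cc, a, b, e, hcc, h, hb⟩ := cInf_hflag_of_isolated_prime hlm hlu hlf hmu hmf huf p hdp (hiso t) (hdiv t)
      (hr t) (hinv t).2.2
    exact ⟨(cc, a, b, e), ⟨hcc, h⟩, hb⟩
  · -- hflagM
    intro t
    obtain ⟨cc, a, b, e, hcc, h, hb⟩ := cInf_hflag_of_isolated_prime (Ne.symm hlm) hmu hmf hlu hlf huf p hdp (hiso t)
      (hdiv t) (hrswap t) (fun e he hef => ((hinv t).2.2 e he hef).symm)
    rw [gameExp_swap] at h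
    exact ⟨(cc, b, a, e), ⟨hcc, h⟩, hb⟩

end Tail

end ResCone

end Summit.ResolutionOfSingularities.ResolutionOfSingularities.Theorems.PIDim4

end
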